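import Summits.Langlands.Langlands.Theses.EisensteinDegreeShift

/-!
# Crux-strategist (suspect = equivalence) — `EisensteinDegreeShift.SectorComplement` (stmt-Langlands-18372): position, one level over

Seat planner-cstrat-stmt-Langlands-18372-q1-0 (unit `cstrat-stmt-Langlands-18372-q1`, gen 1), 2026-08-17.
Route `route-Langlands-EisensteinDegreeShift` (rev 0, DRAFT — tribunal pending). Item
`SectorComplement : Prop := BorelFLReciprocity → _root_.Langlands` (crux rank 9, declared RESIDUAL junction).

This directory `Cruxes/SectorComplement/` is SHARED by the homonymous junction items of ≥ 20 Langlands routes;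
everything of this seat carries the prefix `eds_` and lives in namespace `…Cruxes.SectorComplement.StrategistEDS`.
Companion: the refuter's `Rattack_EisensteinDegreeShift.lean` (same directory; `¬C ↔ X ∧ ¬S`, `S → X`,
`S ↔ X ∧ C`, `(C → S) ↔ X`) and its Negative-lane copy p169529.

What is certified here (kernel-checked, 0 sorry, standard axioms):

* `eds_target_of_cruxes : S1 → S2 → S3 → X` — the route's three CONTENT items (S1 `EisensteinSteinbergSeed`,
  S2 `EisensteinSeededLifting`, S3 `SolubleDescentGLn`) give the target X = `BorelFLReciprocity`; this is the body
  of the route's sorry-free `closes`, extracted so that the conditioning set of the suspected equivalence is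
  explicit: `SectorComplement ↔ Langlands` holds GIVEN X, equivalently GIVEN S1 ∧ S2 ∧ S3 — all three OPEN.
* `eds_sectorComplement_iff_of_target` / `eds_sectorComplement_iff_of_cruxes'` — the suspected equivalence itself,
  with its conditioning hypotheses as explicit binders (nothing unconditional).
* `eds_target_of_langlands'` / `eds_langlands_iff_target_and_sectorComplement'` — the sector is inside the
  summit as typed, so `Langlands ↔ X ∧ C` EXACTLY: the item is the honest complement of the sector (a conjunct
  split with C the declared residual), not the summit in a costume — `(C → Langlands) ↔ X`
  (`eds_sectorComplement_imp_langlands_iff_target'`), i.e. C is summit-strength exactly iff the OPEN sector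
  theorem X is provable.
* `eds_closes_uses_every_content_item` — bookkeeping: with any one of S1/S2/S3 replaced by `True` the glue no
  longer type-checks is not expressible, but the three-way dependence is visible in `eds_target_of_cruxes`
  (S1 supplies K', v₀ and the seed; S2 consumes the seed over K'; S3 descends): see the EQUIVALENCE-AUDIT for the
  per-piece cheap-implication probes (all fail).
-/

set_option linter.dupNamespace false

namespace Summit.Langlands.Langlands.Cruxes.SectorComplement.StrategistEDS

open Summit.Langlands.Langlands.Theses.EisensteinDegreeShift

/-- **The conditioning set, made explicit**: the route's three content items give the target
(`S1 → S2 → S3 → BorelFLReciprocity`). This is literally the inline derivation inside the route's `closes`: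
S1 supplies the soluble CM extension `K'`, the auxiliary place `v₀` and the cuspidal Steinberg seed; S2 lifts
`ρ|K'` from the seed; S3 descends the automorphy to `K`. [folklore] -/
theorem eds_target_of_cruxes (k₁ : EisensteinSteinbergSeed) (k₂ : EisensteinSeededLifting)
    (k₃ : SolubleDescentGLn) : BorelFLReciprocity := by
  intro K _ _ hK n hn p _ hp hur O hO hcpt ι ρ ρ₀ hirr hae hut hFL
  obtain ⟨K', _, _, _, hgal, hsol, hK', hur', ρ₀', hirr', hae', hut', hFL', v₀, hv₀p, hunr, hcpt', hcore⟩ :=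
    k₁ K hK n hn p hp hur O hO ι ρ ρ₀ hirr hae hut hFL
  exact k₃ K K' hgal hsol hK hK' n p hcpt hcpt' ι ρ hirr hirr'
    (k₂ K' hK' n hn p hp hur' O hO hcpt' ι (ρ.restrictField K') ρ₀' hirr' hae' hut' hFL' ⟨v₀, hv₀p, hunr, hcore⟩)

/-- The suspected equivalence with its conditioning hypothesis explicit: under the TARGET,
`SectorComplement ↔ Langlands`. [folklore] -/
theorem eds_sectorComplement_iff_of_target (hX : BorelFLReciprocity) :
    SectorComplement ↔ _root_.Langlands :=
  ⟨fun hC ↦ hC hX, fun h _ ↦ h⟩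

/-- … and under the three content items (all OPEN on the ledger, 2026-08-17): `SectorComplement ↔ Langlands`.
The `→` direction is the route's `closes`; nothing here is unconditional. [folklore] -/
theorem eds_sectorComplement_iff_of_cruxes' (k₁ : EisensteinSteinbergSeed) (k₂ : EisensteinSeededLifting)
    (k₃ : SolubleDescentGLn) : SectorComplement ↔ _root_.Langlands :=
  eds_sectorComplement_iff_of_target (eds_target_of_cruxes k₁ k₂ k₃)

/-- Consistency with the route's own deciding theorem: `closes` factors through `eds_target_of_cruxes`.
[folklore] -/
theorem eds_closes_eq (k₁ : EisensteinSteinbergSeed) (k₂ : EisensteinSeededLifting) (k₃ : SolubleDescentGLn)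
    (hC : SectorComplement) : closes k₁ k₂ k₃ hC = hC (eds_target_of_cruxes k₁ k₂ k₃) :=
  rfl

/-- **The sector is inside the summit as typed**: `Langlands → BorelFLReciprocity` (direction (B) at rank `n`,
`ℓ = p`, `𝓡` from the non-vacuity conjunct, crystalline for the pinned datum ⇒ de Rham for `𝓡.pst`
(`ReciprocityData.pst = fontainePstAdicCompletion` by `rfl`), Satake a.e. = `Corresponds.1`). Re-derived from the
refuter's `eds_target_of_langlands` so that this file is self-contained. [folklore] -/
theorem eds_target_of_langlands' (hL : _root_.Langlands) : BorelFLReciprocity := by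
  intro K _ _ _hK n hn p _ _hp _hur O _hO hcpt ι ρ ρ₀ hirr hae _hut hFL
  obtain ⟨⟨𝓡⟩, h⟩ := hL K
  have hB : Summit.Langlands.GaloisToAutomorphic n 𝓡 hcpt := (h 𝓡 n (by omega) hcpt).2
  have hgeo : Summit.Langlands.IsGeometricFramed 𝓡 ρ :=
    ⟨hae, fun v hv ↦ (hFL v hv).1.isDeRhamFramed⟩
  obtain ⟨π, hLalg, hcorr⟩ := hB p ι ρ hirr hgeo
  exact ⟨π, hLalg, hcorr.1⟩

/-- **Exact bookkeeping identity** `Langlands ↔ X ∧ C`: the target and the declared residual junction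
partition the summit with no typing drift (a CONJUNCT SPLIT in the tribunal's sense, C = the residual).
[folklore] -/
theorem eds_langlands_iff_target_and_sectorComplement' :
    _root_.Langlands ↔ BorelFLReciprocity ∧ SectorComplement :=
  ⟨fun h ↦ ⟨eds_target_of_langlands' h, fun _ ↦ h⟩, fun h ↦ h.2 h.1⟩

/-- **Restates-summit probe, settled**: `(SectorComplement → Langlands) ↔ BorelFLReciprocity` — the junction
is summit-strength EXACTLY iff the open sector theorem is provable. [folklore] -/
theorem eds_sectorComplement_imp_langlands_iff_target' :
    (SectorComplement → _root_.Langlands) ↔ BorelFLReciprocity :=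
  ⟨fun h ↦ Classical.byContradiction fun hX ↦ hX (eds_target_of_langlands' (h fun x ↦ (hX x).elim)),
    fun hX hC ↦ hC hX⟩

/-- Summit given the content items and the junction — the literal type of the route's `Assembly` item,
inhabited (= `closes`). [folklore] -/
theorem eds_assembly_holds : Assembly :=
  fun k₁ k₂ k₃ hC ↦ closes k₁ k₂ k₃ hC

end Summit.Langlands.Langlands.Cruxes.SectorComplement.StrategistEDS
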